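import Summits.CriticalPhenomena.CardyFormulaZ2.Theses.CardyGluingRDE
import Summits.CriticalPhenomena.CardyFormulaZ2.Theorems.CardyGluingRDEBoxMergingSquareCardy
import Literature.Probability.Percolation.GluingRDE
import Literature.Probability.Percolation.BoxArcStateReading
import Literature.Probability.Percolation.MultiResTVSegments

/-!
# Stub `stub_shadowingT` of crux `GluingContraction` (stmt-CriticalPhenomena-8580, line `birth`):
# conditional refutation

The registered stub `stub_shadowingT` of the birth skeleton
(`Cruxes/GluingContraction/Lines/birth.lean`) asserts that the `m`-fold glued `𝕋` prediction
`Ψ^m(lawT at mesh u')` is within `C·2^(−κK)` (multiresolution total variation of the primal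
coordinates) of the true site-`𝕋` law at mesh `u'/2^m`, for all `0 < u' ≤ δ_T(δ₀, K)`.

This file proves that the stub is FALSE granted two inputs, both stated as explicit hypotheses:

* `hCollapse` — the collapse of `Ψ_k = gluingRDE planarCoinGlue (uniform coins)` on laws whose
  states have CONNECTED primal matrices (every two segments related by the equivalence closure of
  "joined"): `(1 − 3·2^{-k}) · μ{connected}^4 ≤ (Ψ_k μ){primal ≡ true}` (pure combinatorics of
  `planarCoinGlue`; the line lead's `psiCollapse_allJoined_ge`, file
  `CardyGluingRDEGluingContractionPsiCollapse`);
* `hAdj` — **the missing percolation estimate**: for site percolation on `𝕋` at `p = 1/2`, two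
  counterclockwise-ADJACENT boundary segments of the square `(0, δ₀)²` at resolution `k` are
  joined inside the window (`triCrossing`) with probability `→ 1` as the mesh `u' → 0⁺`
  (RSW in half-annuli / corners about the common endpoint, e.g. Bollobás–Riordan 2006, Ch. 7,
  Lemma 4 + the Hex lemma; NOT in the tree for the H21 discretisation `triCrossing`).

Mechanism (`stub_shadowingT_false_of_adjacency`): take `m = 1`, `σ = 1`, `δ₀ = 1`, `K ≥ 3` with
`C·2^(−κK) < 1/8`.  By `hAdj` the read state `readT (2^K) 1 u' ω` is connected with probability
`≥ 1 − 1/64` for small `u'` (`connected_of_ccwSucc`), so by `hCollapse` the level-`0` coordinate of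
the prediction at the all-`true` matrix is `≥ (1 − 3/256)(63/64)^4 > 0.92`; the truth at mesh
`u'/2` is at most the bottom–top crossing probability of the square, which tends to
`F(1/2) = 1/2` by Smirnov's theorem (`tendsto_triDomainCrossingProb_square`), so is `≤ 5/8`
for small `u'`.  Since `multiResSum σ K d ≥ d 0 ≥ ½ |difference at one matrix| ≥ 0.15 > 1/8`,
the stub's bound fails at every small enough `u'`, whatever `δ_T` is.
-/

noncomputable section

namespace Summit.CriticalPhenomena.CardyFormulaZ2.Theorems

namespace StubShadowingT

open scoped BigOperators ENNReal Topology
open MeasureTheory Set Filter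
open Literature.Probability.Percolation Literature.Probability.LatticeModels
  Literature.Probability.RandomPlanarGeometry

/-! ### Verbatim copies of the Birth definitions the stub mentions -/

/-- Site percolation on the triangular lattice at `p = 1/2` (the route's `PT`). -/
abbrev PT : Measure (SiteConfig (Site 2)) := triSitePercolation half

/-- The open square window `(0, δ₀)²` (the route's `Sq`; also `Literature…sq`). -/
def Sq (δ₀ : ℝ) : Set ℂ := {z : ℂ | 0 < z.re ∧ z.re < δ₀ ∧ 0 < z.im ∧ z.im < δ₀}

/-- The route's dyadic boundary segment `seg δ₀ j a` (coordinate parametrisation), verbatim. -/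
def rseg (δ₀ : ℝ) (j : ℕ) (a : Fin 4 × Fin (2 ^ j)) : Set ℂ :=
  {z : ℂ | (a.1 = 0 ∧ z.im = 0 ∧ δ₀ * ((a.2 : ℕ) : ℝ) / 2 ^ j ≤ z.re ∧
      z.re ≤ δ₀ * (((a.2 : ℕ) : ℝ) + 1) / 2 ^ j) ∨
    (a.1 = 1 ∧ z.re = δ₀ ∧ δ₀ * ((a.2 : ℕ) : ℝ) / 2 ^ j ≤ z.im ∧
      z.im ≤ δ₀ * (((a.2 : ℕ) : ℝ) + 1) / 2 ^ j) ∨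
    (a.1 = 2 ∧ z.im = δ₀ ∧ δ₀ * ((a.2 : ℕ) : ℝ) / 2 ^ j ≤ z.re ∧
      z.re ≤ δ₀ * (((a.2 : ℕ) : ℝ) + 1) / 2 ^ j) ∨
    (a.1 = 3 ∧ z.re = 0 ∧ δ₀ * ((a.2 : ℕ) : ℝ) / 2 ^ j ≤ z.im ∧
      z.im ≤ δ₀ * (((a.2 : ℕ) : ℝ) + 1) / 2 ^ j)}

/-- The route's state cell `ET δ₀ j u' M` (site-`𝕋`, mesh `u'`), verbatim. -/
def ET (δ₀ : ℝ) (j : ℕ) (u' : ℝ) (M : SegMatrix (2 ^ j)) : Set (SiteConfig (Site 2)) :=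
  {ω | ∀ a b, ω ∈ triCrossing (Sq δ₀) u' (rseg δ₀ j a) (rseg δ₀ j b) ↔ M a b = true}

/-- The site-`𝕋` reading vector at resolution `j` and mesh `u'`: `M ↦ P_𝕋(ET M)`. -/
def tVec (δ₀ : ℝ) (j : ℕ) (u' : ℝ) : SegMatrix (2 ^ j) → ℝ := fun M => PT.real (ET δ₀ j u' M)

/-- **`Ψ_k`**: the planarity-corrected Langlands gluing RDE on laws of resolution-`k` square states,
`gluingRDE planarCoinGlue (uniform law on the 4k coins)`. -/
def Psi (k : ℕ) : PMF (BoxArcState k) → PMF (BoxArcState k) :=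
  gluingRDE (planarCoinGlue (k := k)) (PMF.uniformOfFintype (Fin 4 × Fin k → Bool))

/-- The primal matrix of a state in the ROUTE's coordinate indexing (`toCoord` converts the
counterclockwise positions of `BoxArcState` to the route's coordinate positions; it is an
involution). -/
def primalCoord {k : ℕ} (S : BoxArcState k) : SegMatrix k := fun a b => S.primal (toCoord a) (toCoord b)

/-- Level-`j` coordinates of a law `μ` of resolution-`2^K` states: the real masses of the OR-fusion
`SegMatrix.coarsen K j` of its primal matrix (route indexing). -/
def lawVec (K j : ℕ) (μ : PMF (BoxArcState (2 ^ K))) : SegMatrix (2 ^ j) → ℝ :=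
  fun M => ((μ.map primalCoord).map (SegMatrix.coarsen K j) M).toReal

/-- The empty state (all entries `false`), used only as the value of a junk branch. -/
def emptyState (k : ℕ) : BoxArcState k := ⟨fun _ _ => false, fun _ _ => false⟩

open Classical in
/-- **The site-`𝕋` reading law** at resolution `k`, window `(0, δ₀)²`, mesh `u'`: the law of
`readT k δ₀ u'` under `P_𝕋`, `S ↦ P_𝕋(stateEventT k δ₀ u' S)` (masses sum to `1` for `u' > 0`,
`hasSum_stateEventT`). -/
def lawT (k : ℕ) (δ₀ u' : ℝ) : PMF (BoxArcState k) :=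
  if h : HasSum (fun S => PT (stateEventT k δ₀ u' S)) 1 then ⟨_, h⟩ else PMF.pure (emptyState k)

/-- **Glued `𝕋` prediction**: `Ψ^m` applied to the `𝕋` reading law at mesh `u'`. -/
def predT (K m : ℕ) (δ₀ u' : ℝ) : PMF (BoxArcState (2 ^ K)) := (Psi (2 ^ K))^[m] (lawT (2 ^ K) δ₀ u')

/-! ### The reading law is the law of `readT` (copied from the skeleton) -/

/-- The Boolean indicator of a measurable predicate is measurable. -/
theorem measurable_decide_pred {Ω : Type*} [MeasurableSpace Ω] {p : Ω → Prop} [DecidablePred p]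
    (hp : MeasurableSet {ω | p ω}) : Measurable fun ω => decide (p ω) := by
  refine measurable_to_countable' fun b => ?_
  cases b
  · have : (fun ω => decide (p ω)) ⁻¹' {false} = {ω | p ω}ᶜ := by
      ext ω; simp
    rw [this]; exact hp.compl
  · have : (fun ω => decide (p ω)) ⁻¹' {true} = {ω | p ω} := by
      ext ω; simp
    rw [this]; exact hp

/-- A map into `BoxArcState k` whose two matrix-valued components have measurable Boolean entries
is measurable (the σ-algebra on `BoxArcState k` is discrete, the state space finite). -/
theorem measurable_boxArcState_mk {Ω : Type*} [MeasurableSpace Ω] {k : ℕ}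
    (P D : Ω → ArcRel k) (hP : ∀ a b, Measurable fun ω => P ω a b)
    (hD : ∀ a b, Measurable fun ω => D ω a b) :
    Measurable fun ω => (⟨P ω, D ω⟩ : BoxArcState k) := by
  have hG : Measurable fun ω => (P ω, D ω) :=
    (measurable_pi_lambda _ fun a => measurable_pi_lambda _ fun b => hP a b).prodMk
      (measurable_pi_lambda _ fun a => measurable_pi_lambda _ fun b => hD a b)
  refine measurable_to_countable' fun S => ?_
  have : (fun ω => (⟨P ω, D ω⟩ : BoxArcState k)) ⁻¹' {S} =
      (fun ω => (P ω, D ω)) ⁻¹' {(S.primal, S.dual)} := by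
    ext ω
    simp [BoxArcState.ext_iff]
  rw [this]
  exact hG (measurableSet_singleton _)

/-- The window is bounded. -/
theorem isBounded_sq (δ₀ : ℝ) : Bornology.IsBounded (sq δ₀) := by
  refine (Metric.isBounded_closedBall (x := (0 : ℂ)) (r := |δ₀| + |δ₀|)).subset fun z hz' => ?_
  have hz : 0 < z.re ∧ z.re < δ₀ ∧ 0 < z.im ∧ z.im < δ₀ := hz'
  rw [Metric.mem_closedBall, dist_zero_right]
  calc ‖z‖ ≤ |z.re| + |z.im| := Complex.norm_le_abs_re_add_abs_im z
    _ ≤ |δ₀| + |δ₀| := add_le_add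
        (by rw [abs_of_pos hz.1]; exact hz.2.1.le.trans (le_abs_self δ₀))
        (by rw [abs_of_pos hz.2.2.1]; exact hz.2.2.2.le.trans (le_abs_self δ₀))

/-- `readT k δ₀ u'` is measurable for `u' > 0`. -/
theorem measurable_readT (k : ℕ) (δ₀ : ℝ) {u' : ℝ} (hu' : 0 < u') : Measurable (readT k δ₀ u') := by
  classical
  unfold readT
  refine measurable_boxArcState_mk _ _ (fun a b => ?_) (fun a b => ?_)
  · exact measurable_decide_pred
      (Summit.CriticalPhenomena.CardyFormulaZ2.Theorems.BoxMerging_measurableSet_triCrossing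
        (Ω := sq δ₀) (isBounded_sq δ₀) hu' (ccwSeg δ₀ k a) (ccwSeg δ₀ k b))
  · exact measurable_decide_pred
      ((SiteConfig.complEquiv (Site 2)).measurable
        (Summit.CriticalPhenomena.CardyFormulaZ2.Theorems.BoxMerging_measurableSet_triCrossing
          (Ω := sq δ₀) (isBounded_sq δ₀) hu' (ccwSeg δ₀ k a) (ccwSeg δ₀ k b)))

/-- The fibre masses of a measurable map into a finite discrete space sum to `1`. -/
theorem hasSum_fibre {Ω S : Type*} [MeasurableSpace Ω] [MeasurableSpace S]
    [MeasurableSingletonClass S] [Fintype S] (μ : Measure Ω) [IsProbabilityMeasure μ] {f : Ω → S}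
    (hf : Measurable f) : HasSum (fun s => μ (f ⁻¹' {s})) 1 := by
  have h := hasSum_fintype fun s => μ (f ⁻¹' {s})
  have htot : ∑ s, μ (f ⁻¹' {s}) = 1 := by
    rw [← measure_biUnion_finset (fun s _ t _ hst => ?_) fun s _ => hf (measurableSet_singleton s)]
    · have : (⋃ s ∈ (Finset.univ : Finset S), f ⁻¹' {s}) = univ :=
        eq_univ_of_forall fun ω => mem_iUnion₂.2 ⟨f ω, Finset.mem_univ _, rfl⟩
      rw [this, measure_univ]
    · exact Set.disjoint_iff.2 fun ω ⟨h₁, h₂⟩ => hst ((mem_singleton_iff.1 h₁).symm.trans h₂)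
  rwa [htot] at h

/-- The `𝕋` state masses sum to `1` (`u' > 0`). -/
theorem hasSum_stateEventT (k : ℕ) (δ₀ : ℝ) {u' : ℝ} (hu' : 0 < u') :
    HasSum (fun S => PT (stateEventT k δ₀ u' S)) 1 :=
  hasSum_fibre PT (measurable_readT k δ₀ hu')

/-- **`lawT` is the reading law** for `u' > 0`: `lawT k δ₀ u' S = P_𝕋(stateEventT k δ₀ u' S)`. -/
theorem lawT_apply (k : ℕ) (δ₀ : ℝ) {u' : ℝ} (hu' : 0 < u') (S : BoxArcState k) :
    lawT k δ₀ u' S = PT (stateEventT k δ₀ u' S) := by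
  rw [lawT, dif_pos (hasSum_stateEventT k δ₀ hu')]
  rfl

/-! ### Generic lemmas -/

/-- The masses of a law restricted to a set, summed, are the measure of the preimage (finite
discrete target). -/
theorem tsum_indicator_fibre {Ω S : Type*} [MeasurableSpace Ω] [MeasurableSpace S]
    [MeasurableSingletonClass S] [Fintype S] (μ : Measure Ω) {f : Ω → S} (hf : Measurable f)
    (B : Set S) : ∑' s, B.indicator (fun s => μ (f ⁻¹' {s})) s = μ (f ⁻¹' B) := by
  classical
  rw [tsum_fintype]
  have hsum : ∑ s, B.indicator (fun s => μ (f ⁻¹' {s})) s =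
      ∑ s ∈ Finset.univ.filter (· ∈ B), μ (f ⁻¹' {s}) := by
    rw [Finset.sum_filter]
    exact Finset.sum_congr rfl fun s _ => by by_cases hs : s ∈ B <;> simp [hs]
  rw [hsum, ← measure_biUnion_finset (fun s _ t _ hst => ?_) fun s _ => hf (measurableSet_singleton s)]
  · congr 1
    ext ω
    simp only [mem_iUnion, mem_preimage, mem_singleton_iff, exists_prop, Finset.mem_filter,
      Finset.mem_univ, true_and]
    exact ⟨fun ⟨s, hs, h⟩ => h ▸ hs, fun h => ⟨f ω, h, rfl⟩⟩
  · exact Set.disjoint_iff.2 fun ω ⟨h₁, h₂⟩ => hst ((mem_singleton_iff.1 h₁).symm.trans h₂)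

/-- Union bound for a finite intersection: `μ(⋂ E i) ≥ 1 − Σ (1 − μ(E i))` for a probability
measure and measurable events. -/
theorem one_sub_sum_le_measureReal_iInter {Ω ι : Type*} [MeasurableSpace Ω] [Fintype ι]
    (μ : Measure Ω) [IsProbabilityMeasure μ] {E : ι → Set Ω} (hE : ∀ i, MeasurableSet (E i)) :
    1 - ∑ i, (1 - μ.real (E i)) ≤ μ.real (⋂ i, E i) := by
  have hc : μ.real (⋂ i, E i)ᶜ ≤ ∑ i, (1 - μ.real (E i)) := by
    rw [compl_iInter]
    refine (measureReal_iUnion_fintype_le _).trans (le_of_eq (Finset.sum_congr rfl fun i _ => ?_))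
    exact probReal_compl_eq_one_sub (hE i)
  have h1 : μ.real (⋂ i, E i)ᶜ = 1 - μ.real (⋂ i, E i) :=
    probReal_compl_eq_one_sub (MeasurableSet.iInter hE)
  linarith

/-- One coordinate is dominated by the total variation: `|f M − g M| ≤ 2 · tvFin f g`. -/
theorem abs_sub_le_two_mul_tvFin {α : Type*} [Fintype α] (f g : α → ℝ) (M : α) :
    |f M - g M| ≤ 2 * tvFin f g := by
  have h : |f M - g M| ≤ ∑ s, |f s - g s| :=
    Finset.single_le_sum (f := fun s => |f s - g s|) (fun s _ => abs_nonneg _) (Finset.mem_univ M)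
  unfold tvFin
  linarith

/-! ### Counterclockwise adjacency and connectedness of a segment matrix -/

/-- The counterclockwise successor of a boundary segment at resolution `k ≥ 1`: `(d, t) ↦ (d, t+1)`
inside a side and `(d, k−1) ↦ (d+1, 0)` at a corner. -/
def ccwSucc {k : ℕ} (hk : 1 ≤ k) (a : Fin 4 × Fin k) : Fin 4 × Fin k :=
  if h : (a.2 : ℕ) + 1 < k then (a.1, ⟨(a.2 : ℕ) + 1, h⟩) else (a.1 + 1, ⟨0, hk⟩)

/-- Along one side every segment is chained to the first one, if each segment is joined to its
counterclockwise successor. -/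
theorem eqvGen_side {k : ℕ} (hk : 1 ≤ k) {R : Fin 4 × Fin k → Fin 4 × Fin k → Prop}
    (hR : ∀ a, R a (ccwSucc hk a)) (d : Fin 4) :
    ∀ (n : ℕ) (hn : n < k), Relation.EqvGen R (d, ⟨0, hk⟩) (d, ⟨n, hn⟩)
  | 0, _ => Relation.EqvGen.refl _
  | n + 1, hn => by
    have hprev := eqvGen_side hk hR d n (Nat.lt_of_succ_lt hn)
    have hstep : R (d, ⟨n, Nat.lt_of_succ_lt hn⟩) (d, ⟨n + 1, hn⟩) := by
      have := hR (d, ⟨n, Nat.lt_of_succ_lt hn⟩)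
      simpa [ccwSucc, hn] using this
    exact hprev.trans _ _ _ (Relation.EqvGen.rel _ _ hstep)

/-- The first segment of side `d` is chained to the first segment of side `d + 1`. -/
theorem eqvGen_corner {k : ℕ} (hk : 1 ≤ k) {R : Fin 4 × Fin k → Fin 4 × Fin k → Prop}
    (hR : ∀ a, R a (ccwSucc hk a)) (d : Fin 4) :
    Relation.EqvGen R (d, ⟨0, hk⟩) (d + 1, ⟨0, hk⟩) := by
  have hlast := eqvGen_side hk hR d (k - 1) (Nat.sub_lt hk Nat.one_pos)
  have hstep : R (d, ⟨k - 1, Nat.sub_lt hk Nat.one_pos⟩) (d + 1, ⟨0, hk⟩) := by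
    have := hR (d, ⟨k - 1, Nat.sub_lt hk Nat.one_pos⟩)
    have hnot : ¬ (k - 1 + 1 < k) := by omega
    simpa [ccwSucc, hnot] using this
  exact hlast.trans _ _ _ (Relation.EqvGen.rel _ _ hstep)

/-- **Adjacency gives connectedness**: if every segment is joined to its counterclockwise
successor, every two segments are related by the equivalence closure of "joined". -/
theorem connected_of_ccwSucc {k : ℕ} (hk : 1 ≤ k) {R : Fin 4 × Fin k → Fin 4 × Fin k → Prop}
    (hR : ∀ a, R a (ccwSucc hk a)) (a b : Fin 4 × Fin k) : Relation.EqvGen R a b := by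
  -- every segment is chained to `(0, 0)`
  have h0 : ∀ c : Fin 4 × Fin k, Relation.EqvGen R (0, ⟨0, hk⟩) c := by
    rintro ⟨d, t⟩
    have hside : Relation.EqvGen R (d, ⟨0, hk⟩) (d, t) := by
      have := eqvGen_side hk hR d t.1 t.2
      exact this
    have h01 := eqvGen_corner hk hR 0
    have h12 := eqvGen_corner hk hR 1
    have h23 := eqvGen_corner hk hR 2
    have hd : Relation.EqvGen R (0, ⟨0, hk⟩) (d, ⟨0, hk⟩) := by
      fin_cases d
      · exact Relation.EqvGen.refl _
      · exact h01
      · exact h01.trans _ _ _ h12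
      · exact (h01.trans _ _ _ h12).trans _ _ _ h23
    exact hd.trans _ _ _ hside
  exact ((h0 a).symm _ _).trans _ _ _ (h0 b)

/-! ### The square on `𝕋`: bottom–top crossing probability `→ 1/2` (Smirnov) -/

/-- **The critical square of `𝕋` is crossed with probability `→ 1/2`**: for site percolation on
`δ𝕋` at `p = 1/2`, `P[bottom ↔ top in ((0, δ₀)²)_u] → 1/2` as `u → 0⁺` — Smirnov's theorem
(`hasCrossingLimit_triDomainCrossingProb_holds`) at a uniformizing datum
(`MarkedDomain.exists_isUniformizing_holds`), the diagonal reflection giving cross-ratio `1/2`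
(`ConformalRectangle.crossRatio_eq_half_of_antiAffine`) and `F(1/2) = 1/2`. -/
theorem tendsto_triDomainCrossingProb_square {δ₀ : ℝ} (hδ₀ : 0 < δ₀) :
    Tendsto (triDomainCrossingProb (rectQuad 0 δ₀ 0 δ₀ hδ₀ hδ₀)) (𝓝[>] 0) (𝓝 (1 / 2)) := by
  set R := rectQuad 0 δ₀ 0 δ₀ hδ₀ hδ₀ with hR
  obtain ⟨φ, x, hφx⟩ := MarkedDomain.exists_isUniformizing_holds R
  have h := hasCrossingLimit_triDomainCrossingProb_holds R φ x hφx
  obtain ⟨h0, h1, h2, h3⟩ := RectilinearCardy.Negative.rectQuad_pt (hx := hδ₀) (hy := hδ₀)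
    (x₀ := 0) (x₁ := δ₀) (y₀ := 0) (y₁ := δ₀)
  have hcr : crossRatio x = 1 / 2 := by
    refine ConformalRectangle.crossRatio_eq_half_of_antiAffine R (u := Complex.I) (v := 0)
      (by simp) (by simp) ?_ ?_ ?_ ?_ hφx
    · intro z hz
      rw [hR, mem_rectQuad_carrier] at hz ⊢
      simp only [antiAffine_apply, add_zero, Complex.mul_re, Complex.I_re, Complex.conj_re,
        zero_mul, Complex.I_im, Complex.conj_im, one_mul, zero_sub, neg_neg, Complex.mul_im,
        zero_add, mem_Ioo] at hz ⊢
      exact ⟨hz.2, hz.1⟩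
    · rw [h0]; apply Complex.ext <;> simp
    · rw [h2]; apply Complex.ext <;> simp
    · rw [h1, h3]; apply Complex.ext <;> simp
  rwa [hcr, RectilinearCardy.Negative.cardyFunction_half] at h

/-- The level-`0` truth at the all-`true` matrix is at most the bottom–top crossing probability of
the square (the cell requires in particular `bottom ↔ top`). -/
theorem tVec_zero_allTrue_le {u : ℝ} :
    tVec 1 0 u (fun _ _ => true) ≤
      triDomainCrossingProb (rectQuad 0 1 0 1 one_pos one_pos) u := by
  set R := rectQuad 0 1 0 1 one_pos one_pos with hR
  have hSq : Sq 1 = R.carrier := BoxMerging_sq_eq_rectQuad_carrier one_pos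
  have hA : rseg 1 0 ((0 : Fin 4), ⟨0, by norm_num⟩) = R.arc 0 :=
    BoxMerging_seg_zero_eq_arc_zero one_pos _ rfl
  have hB : rseg 1 0 ((2 : Fin 4), ⟨0, by norm_num⟩) = R.arc 2 :=
    BoxMerging_seg_two_eq_arc_two one_pos _ rfl
  rw [triDomainCrossingProb_eq_measureReal, ← hSq, ← hA, ← hB]
  refine measureReal_mono (fun ω hω => ?_)
  exact (hω _ _).2 rfl

/-! ### The adjacency estimate: the mesh `→ 0⁺` form implies the sequential form -/

/-- The meshes `1/(2^K n)` tend to `0` from the right. -/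
theorem tendsto_mesh_seq (K : ℕ) :
    Tendsto (fun n : ℕ => 1 / (2 ^ K * (n : ℝ))) atTop (𝓝[>] 0) := by
  refine tendsto_nhdsWithin_iff.2 ⟨?_, ?_⟩
  · have h : Tendsto (fun n : ℕ => (2 : ℝ) ^ K * (n : ℝ)) atTop atTop :=
      tendsto_natCast_atTop_atTop.const_mul_atTop (by positivity)
    have h' := h.inv_tendsto_atTop
    refine h'.congr' (Eventually.of_forall fun n => ?_)
    simp only [Pi.inv_apply, one_div]
  · refine eventually_atTop.2 ⟨1, fun n hn => mem_Ioi.2 ?_⟩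
    have : (0 : ℝ) < n := by exact_mod_cast hn
    positivity

/-- **The natural form of the missing estimate implies the form used below.**  If for every
window `δ₀ > 0`, resolution `k ≥ 1` and segment `a`, adjacent segments are joined with
probability `→ 1` as the mesh `→ 0⁺`, then in particular along the meshes `1/(2^K n)` of the unit
square. -/
theorem adjacency_seq_of_tendsto
    (h : ∀ δ₀ : ℝ, 0 < δ₀ → ∀ (k : ℕ) (hk : 1 ≤ k) (a : Fin 4 × Fin k),
      Tendsto (fun u' : ℝ => (triSitePercolation half).real
        (triCrossing (sq δ₀) u' (ccwSeg δ₀ k a) (ccwSeg δ₀ k (ccwSucc hk a)))) (𝓝[>] 0) (𝓝 1))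
    (K : ℕ) (a : Fin 4 × Fin (2 ^ K)) :
    Tendsto (fun n : ℕ => (triSitePercolation half).real
      (triCrossing (sq 1) (1 / (2 ^ K * (n : ℝ))) (ccwSeg 1 (2 ^ K) a)
        (ccwSeg 1 (2 ^ K) (ccwSucc Nat.one_le_two_pow a)))) atTop (𝓝 1) :=
  (h 1 one_pos (2 ^ K) Nat.one_le_two_pow a).comp (tendsto_mesh_seq K)

/-! ### The conditional refutation -/

/-- **`stub_shadowingT` is false, granted the adjacency estimate on `𝕋` and the collapse of `Ψ`.**
Hypotheses: `hAdj` — counterclockwise-adjacent dyadic boundary segments of the unit square are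
joined on `δ𝕋` (`triCrossing`, `p = 1/2`) with probability `→ 1` along the meshes
`δ = 1/(2^K n)`, `n → ∞` (MISSING from the tree; implied by the mesh `→ 0⁺` statement,
`adjacency_seq_of_tendsto`);
`hCollapse` — `(1 − 3·2^{-k}) μ{connected}^4 ≤ (Ψ_k μ){primal ≡ true}` (the line lead's
`psiCollapse_allJoined_ge`).  Conclusion: the negation of the registered signature of
`stub_shadowingT` (verbatim, in the short names of this file = those of the birth skeleton). -/
theorem stub_shadowingT_false_of_adjacency
    (hAdj : ∀ (K : ℕ) (a : Fin 4 × Fin (2 ^ K)),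
      Tendsto (fun n : ℕ => (triSitePercolation half).real
        (triCrossing (sq 1) (1 / (2 ^ K * (n : ℝ))) (ccwSeg 1 (2 ^ K) a)
          (ccwSeg 1 (2 ^ K) (ccwSucc Nat.one_le_two_pow a)))) atTop (𝓝 1))
    (hCollapse : ∀ (k : ℕ) (μ : PMF (BoxArcState k)),
      (1 - 3 * ((2 : ℝ≥0∞) ^ k)⁻¹) *
          μ.toOuterMeasure {S | ∀ a b : Fin 4 × Fin k,
            Relation.EqvGen (fun x y => S.primal x y = true) a b} ^ 4 ≤
        (gluingRDE planarCoinGlue (PMF.uniformOfFintype (Fin 4 × Fin k → Bool)) μ).toOuterMeasure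
          {S | ∀ a b, S.primal a b = true}) :
    ¬ (∀ m : ℕ, 1 ≤ m → ∀ σ : ℝ, 0 < σ → ∃ C κ : ℝ, 0 < C ∧ 0 < κ ∧
      ∀ δ₀ : ℝ, 0 < δ₀ → ∀ K : ℕ, ∃ δT : ℝ, 0 < δT ∧ ∀ u' : ℝ, 0 < u' → u' ≤ δT →
        multiResSum σ K (fun j => tvFin (lawVec K j (predT K m δ₀ u')) (tVec δ₀ j (u' / 2 ^ m)))
          ≤ C * (2 : ℝ) ^ (-(κ * (K : ℝ)))) := by
  intro H
  obtain ⟨C, κ, hC, hκ, H1⟩ := H 1 le_rfl 1 one_pos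
  -- choose `K ≥ 3` with `C · 2^(−κK) < 1/8`
  obtain ⟨K, hK3, hKsmall⟩ : ∃ K : ℕ, 3 ≤ K ∧ C * (2 : ℝ) ^ (-(κ * (K : ℝ))) < 1 / 8 := by
    have hq0 : 0 ≤ (2 : ℝ) ^ (-κ) := Real.rpow_nonneg zero_le_two _
    have hq1 : (2 : ℝ) ^ (-κ) < 1 :=
      Real.rpow_lt_one_of_one_lt_of_neg one_lt_two (neg_lt_zero.2 hκ)
    have ht : Tendsto (fun K : ℕ => C * ((2 : ℝ) ^ (-κ)) ^ K) atTop (𝓝 (C * 0)) :=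
      (tendsto_pow_atTop_nhds_zero_of_lt_one hq0 hq1).const_mul C
    rw [mul_zero] at ht
    have hev := ht.eventually (gt_mem_nhds (show (0 : ℝ) < 1 / 8 by norm_num))
    obtain ⟨K₀, hK₀⟩ := eventually_atTop.1 hev
    refine ⟨max 3 K₀, le_max_left _ _, ?_⟩
    have := hK₀ (max 3 K₀) (le_max_right _ _)
    rwa [← multiResWeight_eq_pow] at this
  set k : ℕ := 2 ^ K with hk
  have hk1 : 1 ≤ k := Nat.one_le_two_pow
  have hk8 : 8 ≤ k := by
    have : 2 ^ 3 ≤ 2 ^ K := Nat.pow_le_pow_right (by norm_num) hK3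
    simpa [hk] using this
  obtain ⟨δT, hδT, H2⟩ := H1 1 one_pos K
  -- the adjacency estimate at `ε = 1/64`, jointly over the `4k` pairs, along `δ = 1/(k n)`
  set E : Fin 4 × Fin k → ℝ → Set (SiteConfig (Site 2)) := fun a u' =>
    triCrossing (sq 1) u' (ccwSeg 1 k a) (ccwSeg 1 k (ccwSucc hk1 a)) with hE
  have hε' : (0 : ℝ) < 1 / 64 / (4 * (k : ℝ)) := by positivity
  have hev : ∀ᶠ n : ℕ in atTop, ∀ a,
      1 - 1 / 64 / (4 * (k : ℝ)) < (triSitePercolation half).real (E a (1 / ((k : ℝ) * n))) := by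
    refine eventually_all.2 fun a => ?_
    have h := (hAdj K a).eventually (lt_mem_nhds (show (1 : ℝ) - 1 / 64 / (4 * (k : ℝ)) < 1 by
      linarith))
    simpa [hk] using h
  obtain ⟨n₀, hn₀⟩ := eventually_atTop.1 hev
  -- Smirnov at `ε = 1/8`
  have hS := tendsto_triDomainCrossingProb_square one_pos
  rw [Metric.tendsto_nhdsWithin_nhds] at hS
  obtain ⟨δS, hδS, hS'⟩ := hS (1 / 8) (by norm_num)
  -- the mesh `u' = 1/(k n)` with `n ≥ n₀` and `1/n < min δT δS`
  have hm : 0 < min δT δS := lt_min hδT hδS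
  set n : ℕ := max (max n₀ 1) (⌈(min δT δS)⁻¹⌉₊ + 1) with hn
  have hn₀n : n₀ ≤ n := (le_max_left _ _).trans (le_max_left _ _)
  have hn1 : 1 ≤ n := (le_max_right _ _).trans (le_max_left _ _)
  have hnpos : (0 : ℝ) < n := by exact_mod_cast hn1
  have hninv : (n : ℝ)⁻¹ < min δT δS := by
    have hceil : (min δT δS)⁻¹ < n := by
      have h1 : (min δT δS)⁻¹ ≤ ⌈(min δT δS)⁻¹⌉₊ := Nat.le_ceil _
      have h2 : ((⌈(min δT δS)⁻¹⌉₊ + 1 : ℕ) : ℝ) ≤ n := by exact_mod_cast le_max_right _ _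
      push_cast at h2
      linarith
    rwa [inv_lt_comm₀ hnpos hm]
  set u' : ℝ := 1 / ((k : ℝ) * n) with hu'
  have hkpos : (0 : ℝ) < k := by exact_mod_cast hk1
  have hu'0 : 0 < u' := by positivity
  have hu'n : u' ≤ (n : ℝ)⁻¹ := by
    have hk1' : (1 : ℝ) ≤ k := by exact_mod_cast hk1
    rw [hu', one_div, mul_inv]
    calc (k : ℝ)⁻¹ * (n : ℝ)⁻¹ ≤ 1 * (n : ℝ)⁻¹ :=
          mul_le_mul_of_nonneg_right (inv_le_one_of_one_le₀ hk1') (inv_nonneg.2 hnpos.le)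
      _ = (n : ℝ)⁻¹ := one_mul _
  have hu'T : u' ≤ δT := (hu'n.trans hninv.le).trans (min_le_left _ _)
  have hu'S : u' < δS := (hu'n.trans_lt hninv).trans_le (min_le_right _ _)
  have hmain := H2 u' hu'0 hu'T
  -- (1) the truth at level 0: `tVec ≤ 5/8`
  have htruth : tVec 1 0 (u' / 2 ^ 1) (fun _ _ => true) ≤ 5 / 8 := by
    have hu2 : 0 < u' / 2 := by positivity
    have hd : dist (triDomainCrossingProb (rectQuad 0 1 0 1 one_pos one_pos) (u' / 2)) (1 / 2) <
        1 / 8 := by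
      refine hS' (mem_Ioi.2 hu2) ?_
      rw [Real.dist_eq, sub_zero, abs_of_pos hu2]; linarith
    rw [Real.dist_eq] at hd
    have := (abs_lt.1 hd).2
    rw [pow_one]
    linarith [tVec_zero_allTrue_le (u := u' / 2)]
  -- (2) the adjacency event has probability `≥ 1 − 1/64`
  have hmeasE : ∀ a, MeasurableSet (E a u') := fun a =>
    BoxMerging_measurableSet_triCrossing (isBounded_sq 1) hu'0 _ _
  have hAdjAll : 1 - 1 / 64 ≤ (triSitePercolation half).real (⋂ a, E a u') := by
    have hpt : ∀ a, 1 - 1 / 64 / (4 * (k : ℝ)) < (triSitePercolation half).real (E a u') :=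
      hn₀ n hn₀n
    have hsum : ∑ a : Fin 4 × Fin k, (1 - (triSitePercolation half).real (E a u')) ≤ 1 / 64 := by
      calc ∑ a : Fin 4 × Fin k, (1 - (triSitePercolation half).real (E a u'))
          ≤ ∑ _a : Fin 4 × Fin k, (1 / 64 / (4 * (k : ℝ)) : ℝ) :=
            Finset.sum_le_sum fun a _ => by linarith [hpt a]
        _ = 1 / 64 := by
            rw [Finset.sum_const, Finset.card_univ, Fintype.card_prod, Fintype.card_fin,
              Fintype.card_fin, nsmul_eq_mul]
            have hk0 : (k : ℝ) ≠ 0 := by positivity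
            push_cast
            field_simp
    linarith [one_sub_sum_le_measureReal_iInter (triSitePercolation half) hmeasE]
  -- (3) the adjacency event forces a connected read state
  set Conn : Set (BoxArcState k) :=
    {S | ∀ a b : Fin 4 × Fin k, Relation.EqvGen (fun x y => S.primal x y = true) a b} with hConn
  have hsub : (⋂ a, E a u') ⊆ readT k 1 u' ⁻¹' Conn := by
    intro ω hω
    have hω' : ∀ a, (readT k 1 u' ω).primal a (ccwSucc hk1 a) = true := fun a =>
      (primal_readT_eq_true_iff ω a _).2 (mem_iInter.1 hω a)
    exact fun a b => connected_of_ccwSucc hk1 (R := fun x y => (readT k 1 u' ω).primal x y = true)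
      hω' a b
  -- (4) the mass of connected states under the reading law
  set μ := lawT k 1 u' with hμ
  have hq : ENNReal.ofReal (1 - 1 / 64) ≤ μ.toOuterMeasure Conn := by
    have hfib : μ.toOuterMeasure Conn = PT (readT k 1 u' ⁻¹' Conn) := by
      rw [PMF.toOuterMeasure_apply]
      have : (fun S => Conn.indicator (⇑μ) S) =
          fun S => Conn.indicator (fun S => PT (readT k 1 u' ⁻¹' {S})) S := by
        funext S
        by_cases hS : S ∈ Conn
        · rw [indicator_of_mem hS, indicator_of_mem hS, hμ, lawT_apply k 1 hu'0 S]; rfl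
        · rw [indicator_of_notMem hS, indicator_of_notMem hS]
      rw [this]
      exact tsum_indicator_fibre PT (measurable_readT k 1 hu'0) Conn
    rw [hfib]
    refine (ENNReal.ofReal_le_of_le_toReal hAdjAll).trans ?_
    exact measure_mono hsub
  -- (5) the collapse: the prediction puts mass `≥ (1 − 3/2^k)(63/64)^4` on "all joined"
  set ν := Psi k μ with hν
  set allJ : Set (BoxArcState k) := {S | ∀ a b, S.primal a b = true} with hallJ
  have hcol : (1 - 3 * ((2 : ℝ≥0∞) ^ k)⁻¹) * μ.toOuterMeasure Conn ^ 4 ≤ ν.toOuterMeasure allJ :=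
    hCollapse k μ
  set M₁ : SegMatrix (2 ^ 0) := fun _ _ => true with hM₁
  have hpred : predT K 1 1 u' = ν := by
    rw [predT, Function.iterate_one]
  have hx : lawVec K 0 (predT K 1 1 u') M₁ =
      (ν.toOuterMeasure (primalCoord ⁻¹' (SegMatrix.coarsen K 0 ⁻¹' {M₁}))).toReal := by
    rw [hpred]
    show (((ν.map primalCoord).map (SegMatrix.coarsen K 0)) M₁).toReal = _
    rw [← PMF.toOuterMeasure_apply_singleton, PMF.toOuterMeasure_map_apply,
      PMF.toOuterMeasure_map_apply]
  have hallJsub : allJ ⊆ primalCoord ⁻¹' (SegMatrix.coarsen K 0 ⁻¹' {M₁}) := by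
    intro S hS
    rw [mem_preimage, mem_preimage, mem_singleton_iff]
    funext a b
    rw [hM₁]
    refine (SegMatrix.coarsen_apply_eq_true_iff K 0 (primalCoord S) a b).2 ?_
    have hsub1 : ∀ i j : Fin (2 ^ 0), i = j := fun i j => by
      apply Fin.ext; have := i.2; have := j.2; simp only [pow_zero] at *; omega
    exact ⟨⟨0, hk1⟩, ⟨0, hk1⟩, hsub1 _ _, hsub1 _ _, hS _ _⟩
  have hxtop : ν.toOuterMeasure (primalCoord ⁻¹' (SegMatrix.coarsen K 0 ⁻¹' {M₁})) ≠ ∞ := by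
    rw [← PMF.toOuterMeasure_map_apply, ← PMF.toOuterMeasure_map_apply,
      PMF.toOuterMeasure_apply_singleton]
    exact PMF.apply_ne_top _ _
  have hpredLB : (1 - 3 / (2 : ℝ) ^ k) * (1 - 1 / 64) ^ 4 ≤ lawVec K 0 (predT K 1 1 u') M₁ := by
    rw [hx]
    refine (ENNReal.ofReal_le_iff_le_toReal hxtop).1 ?_
    refine le_trans ?_ (hcol.trans (measure_mono hallJsub))
    have h1 : (0 : ℝ) ≤ 1 - 3 / (2 : ℝ) ^ k := by
      have : (2 : ℝ) ^ 8 ≤ (2 : ℝ) ^ k := pow_le_pow_right₀ one_le_two hk8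
      rw [sub_nonneg, div_le_one (by positivity)]
      linarith
    rw [ENNReal.ofReal_mul h1, ENNReal.ofReal_pow (by norm_num)]
    refine mul_le_mul' ?_ (pow_le_pow_left' hq 4)
    rw [ENNReal.ofReal_sub _ (by positivity), ENNReal.ofReal_one,
      ENNReal.ofReal_div_of_pos (by positivity), ENNReal.ofReal_pow zero_le_two, ENNReal.ofReal_ofNat,
      ENNReal.ofReal_ofNat, div_eq_mul_inv]
  -- (6) the level-0 discrepancy alone exceeds `1/8`
  have hd0 : 1 / 8 < tvFin (lawVec K 0 (predT K 1 1 u')) (tVec 1 0 (u' / 2 ^ 1)) := by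
    have habs := abs_sub_le_two_mul_tvFin (lawVec K 0 (predT K 1 1 u')) (tVec 1 0 (u' / 2 ^ 1)) M₁
    have hnum : (29 : ℝ) / 32 ≤ (1 - 3 / (2 : ℝ) ^ k) * (1 - 1 / 64) ^ 4 := by
      have h2k : (2 : ℝ) ^ 8 ≤ (2 : ℝ) ^ k := pow_le_pow_right₀ one_le_two hk8
      have ha : (253 : ℝ) / 256 ≤ 1 - 3 / (2 : ℝ) ^ k := by
        have h3 : 3 / (2 : ℝ) ^ k ≤ 3 / (2 : ℝ) ^ 8 :=
          div_le_div_of_nonneg_left (by norm_num) (by positivity) h2k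
        norm_num at h3 ⊢
        linarith
      have hb : (15 : ℝ) / 16 ≤ (1 - 1 / 64 : ℝ) ^ 4 := by norm_num
      nlinarith
    have hle := le_abs_self (lawVec K 0 (predT K 1 1 u') M₁ - tVec 1 0 (u' / 2 ^ 1) M₁)
    linarith
  have hsum0 : tvFin (lawVec K 0 (predT K 1 1 u')) (tVec 1 0 (u' / 2 ^ 1)) ≤
      multiResSum 1 K (fun j => tvFin (lawVec K j (predT K 1 1 u')) (tVec 1 j (u' / 2 ^ 1))) := by
    have := weight_mul_le_multiResSum (σ := 1) (K := K)
      (d := fun j => tvFin (lawVec K j (predT K 1 1 u')) (tVec 1 j (u' / 2 ^ 1)))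
      (fun i => tvFin_nonneg _ _) (Nat.zero_le K)
    rwa [multiResWeight_zero, one_mul] at this
  linarith

end StubShadowingT

end Summit.CriticalPhenomena.CardyFormulaZ2.Theorems

end
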